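import Summits.Ventures.PercRepro.Minor
import Summits.Ventures.PercRepro.C005Eight

/-!
# Dead edges can be deleted: C-005 whenever at most eight edges are live

An edge `e` with `p e = 0` (a **dead** edge) is closed with probability one, so every partition
probability of a marked multigraph equals the same probability in the minor that deletes the dead
edges (`prob_partitionEvent_eq_minor_of_dead`): the weight of a configuration in which every dead
edge is closed is its face weight (`weight_embed_bot_of_dead`), configurations opening a dead edge
have weight `0`, and connectivity transports along `embed` (`conn_embed_iff`, `Minor.lean`).

Hence the ≤ 8-edge theorem `C005_of_card_le_eight'` applies to every marked multigraph with at
most eight LIVE edges, whatever the number of edges of weight `0`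
(`C005_of_card_liveEdges_le_eight`). This is the bridge from the series / parallel substitutions
of `Series.lean` / `Parallel.lean` — which leave the edge type unchanged and create dead edges —
to the finite theorem; `SeriesParallelC005.lean` uses it for every instance that reduces to ≤ 8
live edges.
-/

namespace PercRepro

open Finset

section Weight

variable {E : Type} [Fintype E] [DecidableEq E]

/-- The edges closed in `u` are dead for `p`. -/
def DeadOutside (p : E → ℝ) (u : Config E) : Prop := ∀ e, u e = false → p e = 0

/-- The weight of `p` restricted to a face. -/
def faceWeight (p : E → ℝ) (u v : Config E) : Face u v → ℝ := fun e => p e.1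

omit [Fintype E] [DecidableEq E] in
/-- Restricting a probability vector to a face gives a probability vector. -/
theorem isProb_faceWeight {p : E → ℝ} (hp : IsProb p) (u v : Config E) :
    IsProb (faceWeight p u v) := fun e => hp e.1

omit [Fintype E] [DecidableEq E] in
/-- The face of `u` over `⊥` is the set of edges open in `u`. -/
theorem mem_face_bot_iff (u : Config E) (e : E) :
    ((⊥ : Config E) e = false ∧ u e = true) ↔ u e = true := by
  simp

omit [DecidableEq E] in
/-- When the edges outside `u` are dead, the weight of an embedded face configuration is its face
weight: the dead edges are closed and contribute the factor `1 - 0 = 1`. -/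
theorem weight_embed_bot_of_dead (p : E → ℝ) {u : Config E} (hd : DeadOutside p u)
    (ρ : Config (Face u ⊥)) : weight p (embed u ⊥ ρ) = weight (faceWeight p u ⊥) ρ := by
  unfold weight
  rw [← Fintype.prod_subtype_mul_prod_subtype (fun e : E => (⊥ : Config E) e = false ∧ u e = true)]
  have h1 : (∏ e : {e : E // (⊥ : Config E) e = false ∧ u e = true},
      (if embed u ⊥ ρ e.1 then p e.1 else 1 - p e.1)) =
      ∏ e : Face u ⊥, (if ρ e then faceWeight p u ⊥ e else 1 - faceWeight p u ⊥ e) := by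
    refine Fintype.prod_congr _ _ fun e => ?_
    rw [embed_apply_of_mem u ⊥ ρ e.2]
    rfl
  have h2 : (∏ e : {e : E // ¬ ((⊥ : Config E) e = false ∧ u e = true)},
      (if embed u ⊥ ρ e.1 then p e.1 else 1 - p e.1)) = 1 := by
    refine Finset.prod_eq_one fun e _ => ?_
    have hu : u e.1 = false := by
      have := e.2
      rw [mem_face_bot_iff] at this
      simpa using this
    rw [embed_apply_of_not u ⊥ ρ e.2, hd e.1 hu]
    simp
  rw [h1, h2, mul_one]

omit [DecidableEq E] in
/-- A configuration opening a dead edge has weight `0`. -/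
theorem weight_eq_zero_of_dead_open (p : E → ℝ) {u : Config E} (hd : DeadOutside p u)
    {ω : Config E} (h : ¬ ω ≤ u) : weight p ω = 0 := by
  unfold weight
  have : ∃ e, ω e = true ∧ u e = false := by
    by_contra hcon
    push Not at hcon
    apply h
    intro e
    cases hω : ω e
    · exact bot_le
    · have := hcon e hω
      cases hu : u e
      · exact absurd hu this
      · exact le_rfl
  obtain ⟨e, hωe, hue⟩ := this
  exact Finset.prod_eq_zero (Finset.mem_univ e) (by rw [hωe, hd e hue]; simp)

omit [Fintype E] [DecidableEq E] in
/-- A configuration below `u` is the embedding of its restriction to the face of `u` over `⊥`. -/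
theorem embed_restrict_bot_of_le {u ω : Config E} (h : ω ≤ u) :
    embed u ⊥ (restrict u ⊥ ω) = ω := by
  funext e
  by_cases he : (⊥ : Config E) e = false ∧ u e = true
  · rw [embed_apply_of_mem u ⊥ _ he]
    rfl
  · rw [embed_apply_of_not u ⊥ _ he]
    have hu : u e = false := by
      rw [mem_face_bot_iff] at he
      simpa using he
    have := h e
    rw [hu] at this
    cases hω : ω e
    · rfl
    · rw [hω] at this
      exact absurd this (by simp)

omit [Fintype E] [DecidableEq E] in
/-- An embedded face configuration lies below `u`. -/
theorem embed_bot_le (u : Config E) (ρ : Config (Face u ⊥)) : embed u ⊥ ρ ≤ u := by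
  intro e
  by_cases he : (⊥ : Config E) e = false ∧ u e = true
  · rw [embed_apply_of_mem u ⊥ _ he, he.2]
    exact le_top
  · rw [embed_apply_of_not u ⊥ _ he]
    exact bot_le

/-- **Dead edges do not count**: a sum over all configurations of `weight p · f` is the sum over
the face of `u` when the edges outside `u` are dead. -/
theorem sum_weight_eq_sum_face_of_dead (p : E → ℝ) {u : Config E} (hd : DeadOutside p u)
    (f : Config E → ℝ) :
    ∑ ω : Config E, weight p ω * f ω =
      ∑ ρ : Config (Face u ⊥), weight (faceWeight p u ⊥) ρ * f (embed u ⊥ ρ) := by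
  classical
  rw [← Finset.sum_filter_add_sum_filter_not Finset.univ (fun ω : Config E => ω ≤ u)]
  have h0 : (∑ ω ∈ Finset.univ.filter (fun ω : Config E => ¬ ω ≤ u), weight p ω * f ω) = 0 := by
    refine Finset.sum_eq_zero fun ω hω => ?_
    rw [weight_eq_zero_of_dead_open p hd (Finset.mem_filter.1 hω).2, zero_mul]
  rw [h0, add_zero]
  refine Finset.sum_nbij' (restrict u ⊥) (embed u ⊥) ?_ ?_ ?_ ?_ ?_
  · intro ω _
    exact Finset.mem_univ _
  · intro ρ _
    exact Finset.mem_filter.2 ⟨Finset.mem_univ _, embed_bot_le u ρ⟩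
  · intro ω hω
    exact embed_restrict_bot_of_le (Finset.mem_filter.1 hω).2
  · intro ρ _
    exact restrict_embed u ⊥ ρ
  · intro ω hω
    have hle := (Finset.mem_filter.1 hω).2
    rw [← embed_restrict_bot_of_le hle, restrict_embed, weight_embed_bot_of_dead p hd]

end Weight

namespace MultiGraph

variable {V E : Type} [Fintype E] [DecidableEq E] (G : MultiGraph V E)

omit [Fintype E] [DecidableEq E] in
/-- Membership in a partition event transports along `embed` to the minor. -/
theorem mem_partitionEvent_embed_iff (u v : Config E) (ρ : Config (Face u v)) {k : ℕ}
    (m : Fin k → V) (rgs : Fin k → ℕ) :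
    embed u v ρ ∈ G.partitionEvent m rgs ↔
      ρ ∈ (G.minor u v).partitionEvent (fun i => G.sureClass v (m i)) rgs := by
  unfold partitionEvent
  simp only [Set.mem_setOf_eq]
  constructor
  · intro h i j
    rw [← G.conn_embed_iff u v ρ]
    exact h i j
  · intro h i j
    rw [G.conn_embed_iff u v ρ]
    exact h i j

/-- **Dead edges can be deleted**: when the edges outside `u` are dead for `p`, every partition
probability of `G` equals that of the minor deleting them, at the face weight. -/
theorem prob_partitionEvent_eq_minor_of_dead (p : E → ℝ) {u : Config E} (hd : DeadOutside p u)
    {k : ℕ} (m : Fin k → V) (rgs : Fin k → ℕ) :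
    prob p (G.partitionEvent m rgs) =
      prob (faceWeight p u ⊥) ((G.minor u ⊥).partitionEvent (fun i => G.sureClass ⊥ (m i)) rgs) := by
  classical
  unfold prob
  have hl : ∀ ω : Config E, (G.partitionEvent m rgs).indicator (weight p) ω =
      weight p ω * (if ω ∈ G.partitionEvent m rgs then 1 else 0) := fun ω => by
    by_cases h : ω ∈ G.partitionEvent m rgs <;> simp [Set.indicator, h]
  have hr : ∀ ρ : Config (Face u ⊥),
      ((G.minor u ⊥).partitionEvent (fun i => G.sureClass ⊥ (m i)) rgs).indicator
          (weight (faceWeight p u ⊥)) ρ =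
        weight (faceWeight p u ⊥) ρ *
          (if ρ ∈ (G.minor u ⊥).partitionEvent (fun i => G.sureClass ⊥ (m i)) rgs then 1 else 0) :=
    fun ρ => by
      by_cases h : ρ ∈ (G.minor u ⊥).partitionEvent (fun i => G.sureClass ⊥ (m i)) rgs <;>
        simp [Set.indicator, h]
  rw [Finset.sum_congr rfl fun ω _ => hl ω, Finset.sum_congr rfl fun ρ _ => hr ρ,
    sum_weight_eq_sum_face_of_dead p hd]
  refine Finset.sum_congr rfl fun ρ _ => ?_
  rw [G.mem_partitionEvent_embed_iff u ⊥ ρ m rgs]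

/-- The live edges of `p`, as a configuration. -/
noncomputable def liveConfig (p : E → ℝ) : Config E := fun e => decide (p e ≠ 0)

omit [Fintype E] [DecidableEq E] in
/-- The edges outside `liveConfig p` are dead. -/
theorem deadOutside_liveConfig (p : E → ℝ) : DeadOutside p (liveConfig p) := by
  intro e he
  unfold liveConfig at he
  simpa using he

omit [DecidableEq E] in
/-- The face of the live edges has as many edges as there are live edges. -/
theorem card_face_liveConfig (p : E → ℝ) :
    Fintype.card (Face (liveConfig p) ⊥) = (Finset.univ.filter fun e => p e ≠ 0).card := by
  classical
  rw [Fintype.card_subtype]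
  congr 1
  ext e
  simp [liveConfig]

/-- **C-005 whenever at most eight edges are live** (edges of weight `0` do not count): delete the
dead edges (`prob_partitionEvent_eq_minor_of_dead`) and apply the ≤ 8-edge theorem
`C005_of_card_le_eight'` to the minor. -/
theorem C005_of_card_liveEdges_le_eight (p : E → ℝ) (hp : IsProb p)
    (hlive : (Finset.univ.filter fun e => p e ≠ 0).card ≤ 8) (a b c d : V) :
    prob p (G.partitionEvent ![a, b, c, d] ![0, 0, 1, 1]) *
        prob p (G.partitionEvent ![a, b, c, d] ![0, 1, 0, 1]) +
      prob p (G.partitionEvent ![a, b, c, d] ![0, 0, 1, 1]) *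
        prob p (G.partitionEvent ![a, b, c, d] ![0, 1, 1, 0]) +
      prob p (G.partitionEvent ![a, b, c, d] ![0, 1, 0, 1]) *
        prob p (G.partitionEvent ![a, b, c, d] ![0, 1, 1, 0]) ≤
    prob p (G.partitionEvent ![a, b, c, d] ![0, 0, 0, 0]) *
      prob p (G.partitionEvent ![a, b, c, d] ![0, 1, 2, 3]) := by
  classical
  have hd := deadOutside_liveConfig p
  have hm : (fun i => G.sureClass ⊥ (![a, b, c, d] i)) =
      ![G.sureClass ⊥ a, G.sureClass ⊥ b, G.sureClass ⊥ c, G.sureClass ⊥ d] := by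
    funext i
    fin_cases i <;> rfl
  have key := C005_of_card_le_eight' (G.minor (liveConfig p) ⊥)
    (by rw [card_face_liveConfig]; exact hlive) (faceWeight p (liveConfig p) ⊥)
    (isProb_faceWeight hp _ _) (G.sureClass ⊥ a) (G.sureClass ⊥ b) (G.sureClass ⊥ c)
    (G.sureClass ⊥ d)
  simp only [G.prob_partitionEvent_eq_minor_of_dead p hd, hm]
  exact key

end MultiGraph

end PercRepro
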